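import Summits.CriticalPhenomena.PercolationContinuityZ3.Theorems.PercNearOneGluingNoHeavyQuantFarSunLawDefs
import Mathlib.Algebra.BigOperators.Ring.Finset
import Mathlib.Algebra.Order.BigOperators.Group.Finset
import HarnessLib

/-!
# FAR beyond trees: the VERTEX PRINCIPLE for pattern expectations (multilinearity of the hair law)

builds on p205010 (kernel theorem, internal audit signed; external expert review pending)

Support file (`--supports stmt-CriticalPhenomena-4575`), seat `prim-cert-1` (gen 39); memo
`prim-cert-1/FROM-prim-cert-1-g39-VERTEX-GAME.md` §0(i), §1, §4 (L1).

For a pattern functional `f : Finset ℕ → ℝ` (a function of the SET of open hairs only) the expectation under the hair law,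
`patE[K, f, h] = Σ_{Q ⊆ range K} hairW K h Q · f Q`, is AFFINE in each coordinate `h k` (`HairyCycle.patE_update_affine`).  Hence on a box
`a k ≤ h k ≤ b k` (`k < K`) its minimum is attained at a vertex: **if `m ≤ patE[K, f, v]` for every vertex `v` (`v k ∈ {a k, b k}`), then
`m ≤ patE[K, f, h]` on the whole box** (`HairyCycle.patE_vertex`).  This is the reduction of the layer-2 criterion `(S-avg)` (`G_avg − 1` is such a
pattern expectation, memo §1) on the boxes `[η₁(K), 1]^K` to the `2^K` words over `{η₁(K), 1}`, which finite exact games then certify (memo §3).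
No definitions (`patE[K, f, h]` is a local notation); no sorries; standard axioms.  Elementary multilinear algebra [this work].
-/

noncomputable section

namespace Summit.CriticalPhenomena.PercolationContinuityZ3.Theorems.HairyCycle

open Finset

variable {K : ℕ}

/-- `patE[K, f, h] = Σ_{Q ⊆ range K} hairW K h Q · f Q` — the mean of the pattern functional `f` (a function of the set of open hairs)
when hair `k` is open with probability `h k` independently (a local notation, as `PB[p, m]` in `…QuantCountDP`; no definition). -/
local notation3 "patE[" K ", " f ", " h "]" => ∑ Q ∈ (Finset.range K).powerset, hairW K h Q * (f : Finset ℕ → ℝ) Q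

/-- Factor of the hair law at coordinate `k`: with the other coordinates frozen, `hairW K (update h k x) Q = (x if k ∈ Q else 1 − x) · R`
where `R = ∏_{m ∈ range K ∖ {k}} (h m if m ∈ Q else 1 − h m)` does not depend on `x` (`k < K`). [this work] -/
theorem hairW_update_eq (h : ℕ → ℝ) {k : ℕ} (hk : k < K) (x : ℝ) (Q : Finset ℕ) :
    hairW K (Function.update h k x) Q =
      (if k ∈ Q then x else 1 - x) * ∏ m ∈ (range K).erase k, (if m ∈ Q then h m else 1 - h m) := by
  unfold hairW
  rw [← Finset.mul_prod_erase (range K) _ (Finset.mem_range.2 hk)]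
  congr 1
  · simp only [Function.update_self]
  · refine Finset.prod_congr rfl fun m hm => ?_
    have hmk : m ≠ k := (Finset.mem_erase.1 hm).1
    simp only [Function.update_of_ne hmk]

/-- **Affine in each coordinate**: `patE[K,f,h_x] = patE[K,f,h_0] + x · (patE[K,f,h_1] − patE[K,f,h_0])`, `h_y := update h k y`
(`k < K`, every real `x`). [this work] -/
theorem patE_update_affine (f : Finset ℕ → ℝ) (h : ℕ → ℝ) {k : ℕ} (hk : k < K) (x : ℝ) :
    patE[K, f, (Function.update h k x)] =
      patE[K, f, (Function.update h k 0)] + x * (patE[K, f, (Function.update h k 1)] - patE[K, f, (Function.update h k 0)]) := by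
  have key : ∀ Q ∈ (range K).powerset, hairW K (Function.update h k x) Q * f Q =
      hairW K (Function.update h k 0) Q * f Q +
        x * (hairW K (Function.update h k 1) Q * f Q - hairW K (Function.update h k 0) Q * f Q) := by
    intro Q _
    rw [hairW_update_eq h hk x Q, hairW_update_eq h hk 0 Q, hairW_update_eq h hk 1 Q]
    split_ifs <;> ring
  rw [Finset.sum_congr rfl key, Finset.sum_add_distrib, ← Finset.mul_sum, Finset.sum_sub_distrib]

/-- On a segment an affine function is bounded below by its endpoint values: for `a ≤ x ≤ b`,
`min (patE[K,f,h_a]) (patE[K,f,h_b]) ≤ patE[K,f,h_x]` (`h_y := update h k y`, `k < K`). [this work] -/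
theorem min_patE_update_le (f : Finset ℕ → ℝ) (h : ℕ → ℝ) {k : ℕ} (hk : k < K) {a b x : ℝ} (hax : a ≤ x) (hxb : x ≤ b) :
    min (patE[K, f, (Function.update h k a)]) (patE[K, f, (Function.update h k b)]) ≤ patE[K, f, (Function.update h k x)] := by
  set c := patE[K, f, (Function.update h k 0)] with hc
  set d := patE[K, f, (Function.update h k 1)] - patE[K, f, (Function.update h k 0)] with hd
  have ha : patE[K, f, (Function.update h k a)] = c + a * d := patE_update_affine f h hk a
  have hb : patE[K, f, (Function.update h k b)] = c + b * d := patE_update_affine f h hk b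
  have hx : patE[K, f, (Function.update h k x)] = c + x * d := patE_update_affine f h hk x
  rw [ha, hb, hx]
  rcases le_total 0 d with hd0 | hd0
  · exact le_trans (min_le_left _ _) (by nlinarith)
  · exact le_trans (min_le_right _ _) (by nlinarith)

/-- **VERTEX PRINCIPLE.**  If `m ≤ patE[K, f, v]` for every vertex `v` of the box (`v k = a k ∨ v k = b k` for all `k < K`), then `m ≤ patE[K, f, h]`
for every `h` in the box (`a k ≤ h k ≤ b k` for all `k < K`).  (Coordinates `≥ K` are irrelevant to `patE` and unconstrained.) [this work] -/
theorem patE_vertex (f : Finset ℕ → ℝ) {a b : ℕ → ℝ} {m : ℝ}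
    (hv : ∀ v : ℕ → ℝ, (∀ k, k < K → v k = a k ∨ v k = b k) → m ≤ patE[K, f, v])
    {h : ℕ → ℝ} (hh : ∀ k, k < K → a k ≤ h k ∧ h k ≤ b k) : m ≤ patE[K, f, h] := by
  -- `Q i`: the claim for all `h` in the box whose coordinates `≥ i` (and `< K`) already sit at vertices
  suffices hQ : ∀ i : ℕ, ∀ g : ℕ → ℝ, (∀ k, k < K → a k ≤ g k ∧ g k ≤ b k) →
      (∀ k, i ≤ k → k < K → g k = a k ∨ g k = b k) → m ≤ patE[K, f, g] from
    hQ K h hh fun k hik hkK => absurd hkK (not_lt.2 hik)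
  intro i
  induction i with
  | zero => exact fun g _ hvert => hv g fun k hk => hvert k (Nat.zero_le k) hk
  | succ i ih =>
    intro g hg hvert
    by_cases hiK : i < K
    · -- free coordinate `i`: compare with the two vertex values there
      have hmin := min_patE_update_le f g hiK (hg i hiK).1 (hg i hiK).2
      rw [Function.update_eq_self] at hmin
      have hupd : ∀ y : ℝ, (y = a i ∨ y = b i) → m ≤ patE[K, f, (Function.update g i y)] := by
        intro y hy
        refine ih (Function.update g i y) (fun k hk => ?_) (fun k hik hkK => ?_)
        · by_cases hki : k = i
          · subst hki
            rw [Function.update_self]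
            rcases hy with rfl | rfl
            · exact ⟨le_rfl, (hg k hk).1.trans (hg k hk).2⟩
            · exact ⟨(hg k hk).1.trans (hg k hk).2, le_rfl⟩
          · rw [Function.update_of_ne hki]
            exact hg k hk
        · by_cases hki : k = i
          · subst hki
            rw [Function.update_self]
            exact hy
          · rw [Function.update_of_ne hki]
            exact hvert k (by omega) hkK
      have h1 := hupd (a i) (Or.inl rfl)
      have h2 := hupd (b i) (Or.inr rfl)
      exact le_trans (le_min h1 h2) hmin
    · exact ih g hg fun k hik hkK => hvert k (by omega) hkK

/-- Corollary (lower box edge `η`, upper edge `1`): if `m ≤ patE[K, f, v]` for every word `v` over `{η k, 1}` then `m ≤ patE[K, f, h]` whenever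
`η k ≤ h k ≤ 1` for all `k < K`. [this work] -/
theorem patE_vertex_one (f : Finset ℕ → ℝ) {η : ℕ → ℝ} {m : ℝ}
    (hv : ∀ v : ℕ → ℝ, (∀ k, k < K → v k = η k ∨ v k = 1) → m ≤ patE[K, f, v])
    {h : ℕ → ℝ} (hh : ∀ k, k < K → η k ≤ h k ∧ h k ≤ 1) : m ≤ patE[K, f, h] :=
  patE_vertex f (b := fun _ => 1) hv hh

end Summit.CriticalPhenomena.PercolationContinuityZ3.Theorems.HairyCycle

end
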